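import Mathlib.CategoryTheory.Endomorphism
import Literature.AlgebraicGeometry.Frobenioids.PadicFrobenioidBaseGaloisSystemIndependence
import HarnessLib

/-!
# Transport of the Galois pro-system along an equivalence of bases: "`Ψ` induces `G₁ ⥲ G₂`"

Mochizuki, *The geometry of Frobenioids II*, Kyushu J. Math. **62** (2008), §2, proof of Theorem 2.4 (ii),
p. 20 l.−5 – p. 21 l. 6 [cite: MochizukiFrdII2008, Thm 2.4 (ii) p.20]: "`Ψ` induces a pair of compatible
isomorphisms `G₁ ⥲ G₂`; `K̄₁^× ⥲ K̄₂^×` — where this pair is well-defined up to composition with automorphisms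
of the pair `(G₂, K̄₂^×)` induced by elements of `G₂`."  PROOF-ONLY companion of
`PadicFrobenioidBaseGaloisSystem` ((a)) and `…Independence` ((b)) closing the last formal step of GAP-LEDGER
row G-w5d188-1 (cell abc-iut): the image `c₁ ⋙ E.functor.op` of the Galois pro-system of `B^temp(Π₁)⁰` under
an equivalence of bases `E = Ψ^Base : B^temp(Π₁)⁰ ≌ B^temp(Π₂)⁰` is again a Galois cofinal system, hence
(straightening, (b)) isomorphic to the standard system of `B^temp(Π₂)⁰`; composing the identifications of (a)
gives the printed `Π₁ ≃* Π₂` (up to inner automorphisms).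

* `isGaloisObj_obj_iff` — for `X` in the connected part, "`X` is Galois in `B^temp(Π)`" is the INTRINSIC torsor
  condition `∀ S (ψ₁ ψ₂ : S ⟶ X), ∃ α : Aut X, ψ₁ = ψ₂ ≫ α.hom` inside `B^temp(Π)⁰` ([SemiAnbd] Def 3.1 (iv)),
  which equivalences of bases preserve (`torsor_functor_obj`); `cofinal_comp_equivalence`;
* `exists_iso_galoisSystem_comp_equivalence` — `galoisSystem hG₁ N₁ hN₁ ⋙ E.functor.op ≅ galoisSystem hG₂ N₂ hN₂`
  for some cofinal antitone `N₂`;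
* `nonempty_mulEquiv_of_equivalence` — **`Π₁ ≃* Π₂`** from `E` (= `toAutMulEquiv`, whiskering by `E`,
  `Iso.conjAut`, `toAutMulEquiv⁻¹`);
* `exists_colimit_iso_equivariant_comp_equivalence` — direct limits of any `F : (B^temp(Π₂)⁰)ᵒᵖ ⥤ C` along
  `c₁ ⋙ E.functor.op` are those along the standard system of `Π₂`, equivariantly.

Theorems only; nothing here bears on [IUTchIII] Cor. 3.12.
-/

noncomputable section

namespace Literature.AlgebraicGeometry.Frobenioids

open CategoryTheory CategoryTheory.Limits Opposite Topology Filter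
open Literature.AnabelianGeometry.SemiGraphs
open Literature.AlgebraicGeometry.Frobenioids.QuasiTemperoid.BTempConnected

universe v₃ u₃ u

namespace BaseGaloisSystem

/-! ### The intrinsic Galois (torsor) condition in the connected part; transport along equivalences -/

section Generic

variable {D₁ : Type*} [Category D₁] {D₂ : Type*} [Category D₂]

/-- The torsor condition `∀ S (ψ₁ ψ₂ : S ⟶ X), ∃ α ∈ Aut X, ψ₁ = ψ₂ ≫ α` is preserved by the functor of an
equivalence. [cite: MochizukiSemiAnbd2006, Def 3.1(iv) p.33] -/
theorem torsor_functor_obj (E : D₁ ≌ D₂) {X : D₁}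
    (hX : ∀ (S : D₁) (ψ₁ ψ₂ : S ⟶ X), ∃ α : Aut X, ψ₁ = ψ₂ ≫ α.hom) :
    ∀ (S : D₂) (ψ₁ ψ₂ : S ⟶ E.functor.obj X), ∃ α : Aut (E.functor.obj X), ψ₁ = ψ₂ ≫ α.hom := by
  intro S ψ₁ ψ₂
  let e : E.functor.obj (E.inverse.obj S) ≅ S := E.counitIso.app S
  obtain ⟨α, hα⟩ := hX (E.inverse.obj S) (E.functor.preimage (e.hom ≫ ψ₁)) (E.functor.preimage (e.hom ≫ ψ₂))
  refine ⟨E.functor.mapIso α, ?_⟩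
  have h := congrArg E.functor.map hα
  rw [E.functor.map_preimage, Functor.map_comp, E.functor.map_preimage, Category.assoc] at h
  rw [← cancel_epi e.hom, h]
  rfl

/-- Cofinality of a system is preserved under an equivalence of the target. [cite: MochizukiFrdII2008, Thm 2.4 (ii) p.20] -/
theorem cofinal_comp_equivalence (E : D₁ ≌ D₂) {J : Type*} [Category J] (c : J ⥤ D₁ᵒᵖ)
    (hcof : ∀ X : D₁, ∃ k, Nonempty ((c.obj k).unop ⟶ X)) :
    ∀ Y : D₂, ∃ k, Nonempty (((c ⋙ E.functor.op).obj k).unop ⟶ Y) := by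
  intro Y
  obtain ⟨k, ⟨f⟩⟩ := hcof (E.inverse.obj Y)
  exact ⟨k, ⟨E.functor.map f ≫ (E.counitIso.app Y).hom⟩⟩

end Generic

variable {G : Type u} [Group G] [TopologicalSpace G] [IsTopologicalGroup G]

omit [IsTopologicalGroup G] in
/-- **The intrinsic form of "Galois" in the connected part.**  For an object `X` of `B^temp(Π)⁰`, its underlying
`B^temp(Π)`-object is Galois ([SemiAnbd] Def 3.1 (iv): any two arrows from a connected object differ by an
automorphism) iff the torsor condition holds for arrows INSIDE `B^temp(Π)⁰`. [cite: MochizukiSemiAnbd2006, Def 3.1(iv) p.33] -/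
theorem isGaloisObj_obj_iff (X : ConnectedPart (BTemp G)) :
    IsGaloisObj X.obj ↔ ∀ (S : ConnectedPart (BTemp G)) (ψ₁ ψ₂ : S ⟶ X), ∃ α : Aut X, ψ₁ = ψ₂ ≫ α.hom := by
  constructor
  · rintro ⟨-, h⟩ S ψ₁ ψ₂
    obtain ⟨α, hα⟩ := h S.obj S.property ψ₁.hom ψ₂.hom
    exact ⟨ObjectProperty.isoMk (C := BTemp G) (P := connectedObjects (BTemp G)) α, ObjectProperty.hom_ext _ hα⟩
  · intro h
    refine ⟨X.property, fun S hS ψ₁ ψ₂ => ?_⟩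
    obtain ⟨α, hα⟩ := h ⟨S, hS⟩ (ObjectProperty.homMk ψ₁) (ObjectProperty.homMk ψ₂)
    exact ⟨(connectedObjects (BTemp G)).ι.mapIso α, congrArg InducedCategory.Hom.hom hα⟩

/-! ### The Galois pro-system under an equivalence of bases -/

variable {G₂ : Type u} [Group G₂] [TopologicalSpace G₂] [IsTopologicalGroup G₂]
  (hG : IsTempered G) (hG₂ : IsTempered G₂)
  (E : ConnectedPart (BTemp G) ≌ ConnectedPart (BTemp G₂))
  (N : ℕ → OpenNormalSubgroup G) (hN : Antitone N)

include hG₂ in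
/-- **The image of the Galois pro-system of `B^temp(Π₁)⁰` under an equivalence of bases is a standard system of
`B^temp(Π₂)⁰`** (up to isomorphism): it has Galois terms and is cofinal, so (b)'s straightening applies.
[cite: MochizukiFrdII2008, Thm 2.4 (ii) p.21] -/
theorem exists_iso_galoisSystem_comp_equivalence (hNb : ∀ U ∈ 𝓝 (1 : G), ∃ k, (N k : Set G) ⊆ U) :
    ∃ (N₂ : ℕ → OpenNormalSubgroup G₂) (hN₂ : Antitone N₂),
      (∀ U ∈ 𝓝 (1 : G₂), ∃ k, (N₂ k : Set G₂) ⊆ U) ∧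
        Nonempty (galoisSystem hG N hN ⋙ E.functor.op ≅ galoisSystem hG₂ N₂ hN₂) := by
  refine exists_iso_galoisSystem hG₂ _ (fun k => ?_) ?_
  · -- Galois terms: intrinsic torsor condition, transported along `E`
    rw [isGaloisObj_obj_iff]
    exact torsor_functor_obj E ((isGaloisObj_obj_iff _).1 (isGaloisObj_galoisSystem hG N hN k))
  · exact cofinal_comp_equivalence E _ (galoisSystem_cofinal hG N hN hNb)

include hG hG₂ E in
/-- **[FrdII] Thm. 2.4 (ii), "`Ψ` induces … `G₁ ⥲ G₂`":** an equivalence of the bases `B^temp(Π₁)⁰ ≌ B^temp(Π₂)⁰`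
yields a group isomorphism `Π₁ ≃* Π₂` — `Π₁ ≃* Aut c₁` ((a)), `Aut c₁ ≃* Aut (c₁ ⋙ E.functor.op)` (whiskering by an
equivalence is fully faithful), `≃* Aut c₂` (`Iso.conjAut` of a straightening isomorphism, (b)), `≃* Π₂` ((a));
canonical up to inner automorphisms (the choice in the straightening). [cite: MochizukiFrdII2008, Thm 2.4 (ii) p.21] -/
theorem nonempty_mulEquiv_of_equivalence [SecondCountableTopology G] : Nonempty (G ≃* G₂) := by
  obtain ⟨N, hN, hNb⟩ := exists_antitone_cofinal_seq hG
  obtain ⟨N₂, hN₂, hN₂b, ⟨ι⟩⟩ := exists_iso_galoisSystem_comp_equivalence hG hG₂ E N hN hNb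
  let e₁ : G ≃* Aut (galoisSystem hG N hN) := toAutMulEquiv hG N hN hNb
  let e₂ : Aut (galoisSystem hG N hN) ≃* Aut (galoisSystem hG N hN ⋙ E.functor.op) :=
    (Equivalence.congrRight (E := ℕ) E.op).fullyFaithfulFunctor.autMulEquivOfFullyFaithful (galoisSystem hG N hN)
  let e₃ : Aut (galoisSystem hG N hN ⋙ E.functor.op) ≃* Aut (galoisSystem hG₂ N₂ hN₂) := ι.conjAut
  exact ⟨e₁.trans (e₂.trans (e₃.trans (toAutMulEquiv hG₂ N₂ hN₂ hN₂b).symm))⟩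

section Colimits

variable {C : Type u₃} [Category.{v₃} C] (F : (ConnectedPart (BTemp G₂))ᵒᵖ ⥤ C)

include hG₂ in
/-- **Direct limits along the transported system** `c₁ ⋙ E.functor.op` are those along a standard system of
`B^temp(Π₂)⁰`, equivariantly along `Iso.conjAut` of a straightening isomorphism — the base-structure input that
turns the `σ`-equivariance of `PadicFrd.exists_fieldUnits_colimit_iso_equivariant` (abc-iut-w5-d188) into the
printed "compatible pair … up to elements of `G₂`". [cite: MochizukiFrdII2008, Thm 2.4 (ii) p.21] -/
theorem exists_colimit_iso_equivariant_comp_equivalence (hNb : ∀ U ∈ 𝓝 (1 : G), ∃ k, (N k : Set G) ⊆ U)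
    [HasColimit ((galoisSystem hG N hN ⋙ E.functor.op) ⋙ F)]
    (hF : ∀ (N₂ : ℕ → OpenNormalSubgroup G₂) (hN₂ : Antitone N₂), HasColimit (galoisSystem hG₂ N₂ hN₂ ⋙ F)) :
    ∃ (N₂ : ℕ → OpenNormalSubgroup G₂) (hN₂ : Antitone N₂) (_ : ∀ U ∈ 𝓝 (1 : G₂), ∃ k, (N₂ k : Set G₂) ⊆ U)
      (θ : Aut (galoisSystem hG N hN ⋙ E.functor.op) ≃* Aut (galoisSystem hG₂ N₂ hN₂))
      (e : colimit ((galoisSystem hG N hN ⋙ E.functor.op) ⋙ F) ≅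
        @colimit _ _ _ _ (galoisSystem hG₂ N₂ hN₂ ⋙ F) (hF N₂ hN₂)),
      ∀ σ : Aut (galoisSystem hG N hN ⋙ E.functor.op),
        e.hom ≫ @colimMap _ _ _ _ _ _ (hF N₂ hN₂) (hF N₂ hN₂) (Functor.whiskerRight (θ σ).hom F) =
          colimMap (Functor.whiskerRight σ.hom F) ≫ e.hom :=
  exists_colimit_iso_equivariant_of_galois_cofinal hG₂ F _
    (fun k => (isGaloisObj_obj_iff _).2
      (torsor_functor_obj E ((isGaloisObj_obj_iff _).1 (isGaloisObj_galoisSystem hG N hN k))))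
    (cofinal_comp_equivalence E _ (galoisSystem_cofinal hG N hN hNb)) hF

end Colimits

end BaseGaloisSystem

end Literature.AlgebraicGeometry.Frobenioids

end
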